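import Summits.CriticalPhenomena.PercolationContinuityZ3.Theses.PercNearOneGluing
import Summits.CriticalPhenomena.PercolationContinuityZ3.Theorems.PercNearOneGluingAdditiveGluingThreePointTransfer
import Literature.Probability.Percolation.TwoSetExchange
import Literature.Probability.Percolation.KozmaNitzanPreFKG
import HarnessLib

/-!
# Crux `PercNearOneGluing.AdditiveGluing` (stmt-CriticalPhenomena-4576), line `tieline`: the `Y1`-part of the transfer
# (registered stub `stub_partY1Transfer_c11`)

Support file (`--supports stmt-CriticalPhenomena-4576`, lead c11).  No definitions, no named facts, no sorries.

Weighted graph on `Fin n` (`μ = prodBernoulli w`), relays `u, v`, observer `o`, spectator `c`, extra vertex `b`;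
`D = {u ↮ v}`, `T3 = D ∩ {c ↮ u} ∩ {c ↮ v}` (`u, v, c` pairwise separated), `Y1 = D ∩ {u ↔ b} ∩ {c ↔ u}`
(`b` and `c` both in `C_u`), `π = μ(T3 ∩ {o ↔ c}) / μ(T3)`.  The kernel (T_D) of the crux's three-relay half says that
conditioning on `{b ∈ C_u}` lowers `P_D(o ∈ C_v)` by at least `π` times the drop of `P_D(c ∈ C_v)`; this file proves its
sub-case `Y1` (on `Y1`, `c ∉ C_v`), in conditional form `P_D(Y1) · (P_D(o ↔ v) − π · P_D(c ↔ v)) ≥ P_D(Y1 ∩ {o ↔ v})`, in the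
division-free form

  `μ(T3 ∩ oc) · μ(Y1) · μ(D ∩ vc) + μ(T3) · μ(D) · μ(Y1 ∩ vo) ≤ μ(T3) · μ(Y1) · μ(D ∩ vo)`.

Proof.  (a) The three-point transfer `threePointTransfer` (3PT, landed):
`μ(T3 ∩ oc)·μ(D ∩ vc)·μ(D ∩ vcᶜ) ≤ μ(T3)·(μ(D)·μ(D ∩ vo ∩ vc) − μ(D ∩ vo)·μ(D ∩ vc))`, which with
`μ(D) = μ(D ∩ vc) + μ(D ∩ vcᶜ)`, `μ(D ∩ vo) = μ(D ∩ vo ∩ vc) + μ(D ∩ vcᶜ ∩ vo)` reads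
`P_D(o ↔ v) − π·P_D(c ↔ v) ≥ P_D(o ↔ v | c ∉ C_v)`.
(b) One two-set exchange (van den Berg–Häggström–Kahn, Thm. 2.1 at `q = 1` with vertex sets, tree `setTwoClusterExchange`)
for `S = {u, c}`, `T = {v}`: `{S ↮ T} = D ∩ {v ↮ c}`, the event `{u ↔ b} ∩ {u ↔ c}` is of type `(+)` and `{v ↔ o}` of type
`(−)`, whence `P_D(o ↔ v | Y1) ≤ P_D(o ↔ v | c ∉ C_v)` (`PartY1Transfer.stepGP`).
(c) Linear arithmetic (`PartY1Transfer.alg`): `μ(D ∩ vcᶜ)·(goal slack) = μ(Y1)·(3PT slack) + μ(T3)·μ(D)·((b) slack)`, and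
`Y1 ⊆ D ∩ vcᶜ` disposes of `μ(D ∩ vcᶜ) = 0`.
[cite: VandenbergHaggstromKahn2005, Thm. 1.3 (p. 6), Thm. 1.5 (p. 7), Thm. 2.1 (p. 9) with Remark 1 after Thm. 1.2 (p. 5)]
[cite: KozmaNitzan2024, Lemma 4 (p. 9), Question 7 (p. 36)]
-/

namespace Summit.CriticalPhenomena.PercolationContinuityZ3.Cruxes.AdditiveGluing.TieLine

open MeasureTheory Set Literature.Probability.LatticeModels Literature.Probability.Percolation
open Summit.CriticalPhenomena.PercolationContinuityZ3.Theorems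

noncomputable section

namespace PartY1Transfer

variable {n : ℕ}

/-! ### Linear arithmetic -/

/-- The arithmetic of the `Y1`-part: in the variables `pD = μ(D)`, `pvo = μ(D ∩ vo)`, `pvc = μ(D ∩ vc)`, `pcb = μ(D ∩ vcᶜ)`,
`pocv = μ(D ∩ vo ∩ vc)`, `pocb = μ(D ∩ vcᶜ ∩ vo)`, `t = μ(T3)`, `toc = μ(T3 ∩ oc)`, `y1 = μ(Y1)`, `y1o = μ(Y1 ∩ vo)`, from the
splits `hD`, `hDo`, the three-point transfer `h3` and the exchange `hb` to the goal; the certificate is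
`pcb·(goal slack) = y1·(h3 slack) + t·pD·(hb slack)`, and `y1o ≤ y1 ≤ pcb` handles `pcb = 0`. [folklore] -/
theorem alg {toc t pD pvo pvc pcb pocv pocb y1 y1o : ℝ} (hD : pD = pvc + pcb) (hDo : pvo = pocv + pocb)
    (h3 : toc * (pvc * pcb) ≤ t * (pD * pocv - pvo * pvc)) (hb : y1o * pcb ≤ y1 * pocb)
    (hy1le : y1 ≤ pcb) (hy1ole : y1o ≤ y1) (ht0 : 0 ≤ t) (hpvc0 : 0 ≤ pvc) (hpcb0 : 0 ≤ pcb) (hy10 : 0 ≤ y1)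
    (hy1o0 : 0 ≤ y1o) :
    toc * (y1 * pvc) + t * (pD * y1o) ≤ t * (y1 * pvo) := by
  subst hD hDo
  rcases hpcb0.eq_or_lt with hpcb | hpcb
  · have hy1 : y1 = 0 := le_antisymm (hpcb ▸ hy1le) hy10
    have hy1o : y1o = 0 := le_antisymm (hy1 ▸ hy1ole) hy1o0
    rw [hy1, hy1o]
    simp
  · have key : pcb * (toc * (y1 * pvc) + t * ((pvc + pcb) * y1o)) ≤ pcb * (t * (y1 * (pocv + pocb))) := by
      nlinarith [mul_le_mul_of_nonneg_left h3 hy10,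
        mul_le_mul_of_nonneg_left hb (mul_nonneg ht0 (add_nonneg hpvc0 hpcb0))]
    exact le_of_mul_le_mul_left key hpcb

/-! ### Set identities -/

/-- `{u↮v} ∩ {c↮v} ∩ ({u↔b} ∩ {u↔c}) = D ∩ {u↔b} ∩ {c↔u} = Y1` (`u ↮ v` and `c ↔ u` force `c ↮ v`). [folklore] -/
theorem GP_Y1_eq (b u v c : Fin n) :
    ((openConn u v)ᶜ ∩ (openConn c v)ᶜ ∩ (openConn u b ∩ openConn u c) : Set (BondConfig (Fin n))) =
      (openConn u v)ᶜ ∩ openConn u b ∩ openConn c u := by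
  ext ω
  simp only [mem_inter_iff, mem_compl_iff, openConn, mem_setOf_eq]
  constructor
  · rintro ⟨⟨huv, -⟩, hub, huc⟩
    exact ⟨⟨huv, hub⟩, huc.symm⟩
  · rintro ⟨⟨huv, hub⟩, hcu⟩
    exact ⟨⟨huv, fun hcv => huv (hcu.symm.trans hcv)⟩, hub, hcu.symm⟩

/-- `{u↮v} ∩ {c↮v} ∩ ({u↔b} ∩ {u↔c} ∩ {v↔o}) = Y1 ∩ {v↔o}`. [folklore] -/
theorem GP_Y1o_eq (o b u v c : Fin n) :
    ((openConn u v)ᶜ ∩ (openConn c v)ᶜ ∩ (openConn u b ∩ openConn u c ∩ openConn v o) : Set (BondConfig (Fin n))) =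
      (openConn u v)ᶜ ∩ openConn u b ∩ openConn c u ∩ openConn v o := by
  ext ω
  simp only [mem_inter_iff, mem_compl_iff, openConn, mem_setOf_eq]
  constructor
  · rintro ⟨⟨huv, -⟩, ⟨hub, huc⟩, hvo⟩
    exact ⟨⟨⟨huv, hub⟩, huc.symm⟩, hvo⟩
  · rintro ⟨⟨⟨huv, hub⟩, hcu⟩, hvo⟩
    exact ⟨⟨huv, fun hcv => huv (hcu.symm.trans hcv)⟩, ⟨hub, hcu.symm⟩, hvo⟩

/-- `Y1 = D ∩ {u↔b} ∩ {c↔u} ⊆ D ∩ {v↮c}` (`v ↔ c ↔ u` would join `u` to `v`). [folklore] -/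
theorem Y1_subset (b u v c : Fin n) :
    ((openConn u v)ᶜ ∩ openConn u b ∩ openConn c u : Set (BondConfig (Fin n))) ⊆ (openConn u v)ᶜ ∩ (openConn v c)ᶜ := by
  intro ω hω
  simp only [mem_inter_iff, mem_compl_iff, openConn, mem_setOf_eq] at hω ⊢
  obtain ⟨⟨huv, -⟩, hcu⟩ := hω
  exact ⟨huv, fun hvc => huv (hvc.trans hcu).symm⟩

/-! ### The exchange step -/

/-- **(GP)** Set-BHK for `S = {u, c}`, `T = {v}` (`{S ↮ T} = D ∩ {v↮c}`): `{u↔b} ∩ {u↔c}` is of type `(+)` and `{v↔o}`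
of type `(−)`, so `μ(Y1 ∩ vo) · μ(D ∩ vcᶜ) ≤ μ(Y1) · μ(D ∩ vcᶜ ∩ vo)`, i.e. `P_D(o ↔ v | Y1) ≤ P_D(o ↔ v | c ∉ C_v)`.
[cite: VandenbergHaggstromKahn2005, Thm. 2.1 (p. 9) at q = 1 with Remark 1 after Thm. 1.2 (p. 5)] -/
theorem stepGP (w : Sym2 (Fin n) → unitInterval) (o b u v c : Fin n) :
    (prodBernoulli w).real ((openConn u v)ᶜ ∩ openConn u b ∩ openConn c u ∩ openConn v o : Set (BondConfig (Fin n))) *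
        (prodBernoulli w).real ((openConn u v)ᶜ ∩ (openConn v c)ᶜ : Set (BondConfig (Fin n))) ≤
      (prodBernoulli w).real ((openConn u v)ᶜ ∩ openConn u b ∩ openConn c u : Set (BondConfig (Fin n))) *
        (prodBernoulli w).real ((openConn u v)ᶜ ∩ (openConn v c)ᶜ ∩ openConn v o : Set (BondConfig (Fin n))) := by
  have key := setTwoClusterExchange w ({u, c} : Set (Fin n)) ({v} : Set (Fin n))
    (A₁ := openConn u b ∩ openConn u c) (A₂ := univ) (B₁ := openConn v o) (B₂ := univ)
    (fun _ _ h1 h2 hω =>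
      ⟨TwoSetExchange.typePlus_openConn_of_mem ({u, c} : Set (Fin n)) ({v} : Set (Fin n)) (s₀ := u) (by simp) b h1 h2
          hω.1,
        TwoSetExchange.typePlus_openConn_of_mem ({u, c} : Set (Fin n)) ({v} : Set (Fin n)) (s₀ := u) (by simp) c h1 h2
          hω.2⟩)
    (fun _ _ _ _ _ => mem_univ _)
    (TwoSetExchange.typeMinus_openConn_of_mem ({u, c} : Set (Fin n)) ({v} : Set (Fin n)) (t₀ := v) (by simp) o)
    (fun _ _ _ _ _ => mem_univ _)
  rw [ThreePointTransfer.sep_vc_u_eq v u c] at key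
  simp only [inter_univ] at key
  rw [GP_Y1o_eq o b u v c, GP_Y1_eq b u v c, KNPreFKG.openConn_symm c v] at key
  exact key

end PartY1Transfer

open PartY1Transfer in
/-- **`Y1`-part of the transfer** (registered stub `stub_partY1Transfer_c11`, line `tieline`, crux `AdditiveGluing`; lead c11):
with `D = {u ↮ v}`, `T3 = D ∩ {c ↮ u} ∩ {c ↮ v}`, `Y1 = D ∩ {u ↔ b} ∩ {c ↔ u}`,
`μ(T3 ∩ {o↔c})·μ(Y1)·μ(D ∩ {v↔c}) + μ(T3)·μ(D)·μ(Y1 ∩ {v↔o}) ≤ μ(T3)·μ(Y1)·μ(D ∩ {v↔o})`, i.e.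
`P_D(Y1)·(P_D(o ↔ v) − π·P_D(c ↔ v)) ≥ P_D(Y1, o ↔ v)` with `π = P(o ↔ c | u, v, c pairwise separated)` — the sub-case
`Y1 = {b ∈ C_u} ∩ {c ∈ C_u}` of the kernel (T_D).  From the three-point transfer `threePointTransfer`, one two-set exchange
(`PartY1Transfer.stepGP`) and linear arithmetic (`PartY1Transfer.alg`).
[cite: VandenbergHaggstromKahn2005, Thm. 1.3 (p. 6), Thm. 1.5 (p. 7), Thm. 2.1 (p. 9)] [cite: KozmaNitzan2024, Question 7 (p. 36)] -/
theorem stub_partY1Transfer_c11 : ∀ (n : ℕ) (w : Sym2 (Fin n) → unitInterval) (o b u v c : Fin n), (Literature.Probability.LatticeModels.prodBernoulli w).real ((Literature.Probability.Percolation.openConn u v)ᶜ ∩ ((Literature.Probability.Percolation.openConn c u)ᶜ ∩ (Literature.Probability.Percolation.openConn c v)ᶜ) ∩ Literature.Probability.Percolation.openConn o c : Set (Literature.Probability.Percolation.BondConfig (Fin n))) * ((Literature.Probability.LatticeModels.prodBernoulli w).real ((Literature.Probability.Percolation.openConn u v)ᶜ ∩ Literature.Probability.Percolation.openConn u b ∩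 Literature.Probability.Percolation.openConn c u : Set (Literature.Probability.Percolation.BondConfig (Fin n))) * (Literature.Probability.LatticeModels.prodBernoulli w).real ((Literature.Probability.Percolation.openConn u v)ᶜ ∩ Literature.Probability.Percolation.openConn v c : Set (Literature.Probability.Percolation.BondConfig (Fin n)))) + (Literature.Probability.LatticeModels.prodBernoulli w).real ((Literature.Probability.Percolation.openConn u v)ᶜ ∩ ((Literature.Probability.Percolation.openConn c u)ᶜ ∩ (Literature.Probability.Percolation.openConn c v)ᶜ) : Set (Literature.Probability.Percolation.BondConfig (Fin n))) * ((Literature.Probability.LatticeModels.prodBernoulli w).real ((Literature.Probability.Percolation.openConn u v)ᶜ : Set (Literature.Probability.Percolation.BondConfig (Fin n))) * (Literature.Probability.LatticeModels.prodBernoulli w).real ((Literature.Probability.Percolation.openConn u v)ᶜ ∩ Literature.Probability.Percolation.openConn u b ∩ Literature.Probability.Percolation.openConn c u ∩ Literature.Probability.Percolation.openConn v o : Set (Literature.Probability.Percolation.BondConfig (Fin n)))) ≤ (Literature.Probability.LatticeModels.prodBernoulli w).real ((Literature.Probability.Percolation.openConn u v)ᶜ ∩ ((Literature.Probability.Percolation.openConn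 c u)ᶜ ∩ (Literature.Probability.Percolation.openConn c v)ᶜ) : Set (Literature.Probability.Percolation.BondConfig (Fin n))) * ((Literature.Probability.LatticeModels.prodBernoulli w).real ((Literature.Probability.Percolation.openConn u v)ᶜ ∩ Literature.Probability.Percolation.openConn u b ∩ Literature.Probability.Percolation.openConn c u : Set (Literature.Probability.Percolation.BondConfig (Fin n))) * (Literature.Probability.LatticeModels.prodBernoulli w).real ((Literature.Probability.Percolation.openConn u v)ᶜ ∩ Literature.Probability.Percolation.openConn v o : Set (Literature.Probability.Percolation.BondConfig (Fin n)))) := by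
  intro n w o b u v c
  obtain ⟨hD, hDo⟩ := ThreePointTransfer.real_D_split w o u v c
  exact alg hD hDo (threePointTransfer n w o u v c) (stepGP w o b u v c) (measureReal_mono (Y1_subset b u v c))
    (measureReal_mono inter_subset_left) measureReal_nonneg measureReal_nonneg measureReal_nonneg measureReal_nonneg
    measureReal_nonneg

end

end Summit.CriticalPhenomena.PercolationContinuityZ3.Cruxes.AdditiveGluing.TieLine
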